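import Summits.RiemannHypothesis.RiemannHypothesis.Theorems.EtaLeadingQuarterWeakLockingLayer
import Summits.RiemannHypothesis.RiemannHypothesis.Theses.EtaLeadingQuarter
import HarnessLib

/-!
# `LockingToWeak` (route EtaLeadingQuarter, aside stmt-RiemannHypothesis-22405)

The bridge `LockingToWeak : (strong Euler-ended locking layer of route EtaTailTrialBound) → WeakLockingLayer`
was filed so that a prover of L15's `LockingLayer` would close `WeakLockingLayer` (21792) for free. Since
`WeakLockingLayer` itself is now PROVED unconditionally (`Locking.weakLockingLayer_proof`, p577293, the
explicit log-scale Gaussian layer), the implication holds with the hypothesis unused; we record it so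
the ledger item closes. (The intended two-line construction `e♯ = e − ½(−1)^M M^{-1/2}·1_{m=M}`,
`‖e♯‖² ≤ 2‖e‖² + 1/(2M)`, `Z_M(e♯) ≤ 2 Z_M(e) + B₀/(2M)` is thereby unnecessary.) RH-free; nothing
here bears on the truth of RH.
-/

set_option linter.dupNamespace false  -- the mandated namespace repeats `RiemannHypothesis`

namespace Summit.RiemannHypothesis.RiemannHypothesis.Theorems.EtaLeadingQuarter.Locking

/-- **`LockingToWeak` holds** (item stmt-RiemannHypothesis-22405): its conclusion `WeakLockingLayer` is
proved outright by `weakLockingLayer_proof`. [folklore] -/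
theorem lockingToWeak_proof :
    Summit.RiemannHypothesis.RiemannHypothesis.Theses.EtaLeadingQuarter.LockingToWeak :=
  fun _ ↦ weakLockingLayer_proof

end Summit.RiemannHypothesis.RiemannHypothesis.Theorems.EtaLeadingQuarter.Locking
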